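import Literature.NumberTheory.Rogawski1990.OneDimAutRepHArchType              -- ★ `OneDimAutRepH.ofAutomorphic` (archimedean types automatic), `bcη`, `bcψ`
import Literature.NumberTheory.Automorphic.Liu2021.CheckOfChiGalConj            -- ★ `HeckeCharacter.checkOfChi` (`χ̌(x) = χ(x_f ∕ x_fᶜ)`), `checkOfChi_ideleBaseChange`
import Literature.RepresentationTheory.Liu2021.OscillatorConventions           -- ★ `isOscillatorChar_toHeckeCharacter_iff` (conjugate symplectic ⟺ `μ̃|_{𝕀_{L⁺}} = ε`)
import Literature.NumberTheory.Automorphic.Liu2021.Def411WeilCarriersChiUnitary -- ★ `norm_chi_eq_one_cm` (automorphic `χ` is unitary)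
import Summits.HodgeConjecture.HodgeConjecture.Theorems.F0P2oLocalLettersHold  -- ★ `GR91Lemma512NonsplitAsPrinted_holds` (#76 U′-N, hypothesis-free)
import HarnessLib

/-!
# Crux `H413`, programme P2 — THE FORWARD GLOBAL DICTIONARY `(μ, χ) ↦ ξ`: a one-dimensional automorphic `ξ = (η, ψ)` of
# `H = U(2) × U(1)` attached to Liu's theta datum `(μ, χ)` and Rogawski's auxiliary `μω`, satisfying the two dictionary pins of letter #76

Cell hodgecm-mathlib (D-0151), FLOOR 0, crux item H413 = stmt-HodgeConjecture-24833, programme P2 (theta ∕ `hdictE`); seat F0P2-p06 (g9), road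
«S2♯-θ» FILE 1 (FINDING 2026-09-01T15:01Z: the REL-ENGINE head `F0P2E3RelEngine.relParity_of_engine` consumes the print letter S2♯ #80 only through
its FINITE clause at THETA-type `P`; that clause needs a GLOBAL `ξ` attached to `(μ, χ)` — this file — and the ★ local dictionaries).  THEOREMS ONLY
(no `def`, no instance, no notation, no named fact, no `sorry`); no `Cruxes/…/Lines` import (O50-1); kernel lane `--supports stmt-HodgeConjecture-24833`.
HONEST LABEL: HC_CM is proved only modulo the 2 remaining named inputs (hLiu418, h413) until rung 0 closes; this file asserts nothing printed — it is
Hecke-character algebra over the ★ idelic Hilbert-90 dictionary.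

THE MATHEMATICS ([Rogawski1990, §12.2 p. 174, §13.1 p. 199]; [GelbartRogawski1991, §5.1 (5.1.1) p. 465]).  The tree has the REVERSE dictionary
★ `F0P2iGRDWitness.grdMu ∕ grdChi` (`ξ ↦ (μ_ξ, χ_ξ)`): `μ̃_ξ = η̃⁻¹ψ̃⁻¹μω`, `χ_ξ(z∕z̄) = (ψ̃⁻¹μ̃_ξ²)(1, z)`.  Conversely, GIVEN a conjugate-symplectic
`μ : C_L → S¹` (★ `IsConjugateSymplectic`: `μ̃|_{𝕀_{L⁺}} = ε_{L∕L⁺}`, ★ `isOscillatorChar_toHeckeCharacter_iff`), an automorphic character `χ` of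
`L¹∖U(1)(𝔸_{L⁺,f})` (★ `Chi`) and ANY Hecke character `μω` with `μω|_{𝕀_{L⁺}} = ε_{L∕L⁺}`, put `μ̃ := toHeckeCharacter μ`, `χ̌(x) := χ(x_f∕x̄_f)`
(★ `HeckeCharacter.checkOfChi`), and
  `ψ̃ := μ̃² · χ̌⁻¹`,   `η̃ := μω · μ̃⁻¹ · ψ̃⁻¹`.
Both are trivial on `𝕀_{L⁺}` (`ε² = 1`, ★ `quadraticHeckeCharCM_sq`; `χ̌|_{𝕀_{L⁺}} = 1`, ★ `checkOfChi_ideleBaseChange`), hence DESCEND to automorphic characters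
`ψ`, `η` of the norm-one torus `T(𝔸_{L⁺})` (idelic Hilbert 90, ★ `TorusDict.exists_pullback_eq`), and `ξ := (η, ψ)` is a one-dimensional automorphic
representation of `H` (★ `OneDimAutRepH.ofAutomorphic`: the even archimedean types are automatic).  By construction (commutative-group algebra)
  `η̃⁻¹ · ψ̃⁻¹ · μω = μ̃`   and   `ψ̃⁻¹ · (η̃⁻¹ψ̃⁻¹μω)² = χ̌`,
which are EXACTLY the two dictionary pins (hdμ), (hdχ) of ★ letter #76 `GelbartRogawski1991.GR91Lemma512NonsplitAsPrinted` (hypothesis-free in the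
tree: ★ `F0P2oLocalLettersHold.GR91Lemma512NonsplitAsPrinted_holds`).

* §1 `exists_xi_dictionary` — `∃ ξ, μ̃ = ξ.bcη⁻¹ * ξ.bcψ⁻¹ * μω ∧ χ̌ = ξ.bcψ⁻¹ * (ξ.bcη⁻¹ * ξ.bcψ⁻¹ * μω) ^ 2`; the pins in #76's literal shapes
  (`exists_xi_dictionary_pins`: semilocal components at every finite place of `L⁺`, and `χ (z∕z̄) = … (1_∞, z)` for every finite idèle `z`).
* §2 `exists_xi_thetaType_in_xiPrincipalSeries` — consequence over ★ #76: ONE global `ξ` (depending on `μ`, `χ`, `μω` only) such that at EVERY non-split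
  place and every frame the local theta type `X_v(μ, ε, χ)` (some line class `ε`) is a constituent of the principal series `i_G(χ_{ξ,v})` of `ξ`
  — the non-split local clause of «`Θ_μ(χ) ∈ Π(ξ)`» with `ξ` GLOBAL.

## References
* [Rogawski1990] J. Rogawski, *Automorphic Representations of Unitary Groups in Three Variables*, Ann. of Math. Stud. 123 (1990): §12.2 (2) p. 174; §13.1 p. 199.
* [GelbartRogawski1991] S. Gelbart, J. Rogawski, Invent. Math. 105 (1991): §5.1 (5.1.1) p. 465, Lem. 5.1.2 pp. 465–466.
* [Liu2021] Y. Liu, arXiv:2102.11518: Def. 4.1, Def. 4.11 (l. 2090), App. D §D.1 (l. 5224).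
* [CasselsFrohlichANT1967] Ch. VII (Tate) §7.4 (idelic Hilbert 90).
-/

set_option autoImplicit false
-- the mandated namespace repeats the single-problem summit's segment (`HodgeConjecture.HodgeConjecture`)
set_option linter.dupNamespace false

noncomputable section

open NumberField IsDedekindDomain
open scoped Matrix

open Literature.NumberTheory Literature.NumberTheory.Automorphic Literature.NumberTheory.Automorphic.UnitaryGroup
open Literature.NumberTheory.Automorphic.IdeleClassGroup
open Literature.NumberTheory.Automorphic.Liu2021 Literature.NumberTheory.Automorphic.Liu2021.Def411WeilCarriers
open Literature.NumberTheory.Automorphic.Liu2021.CheckOfChi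
open Literature.NumberTheory.GaloisRepresentations
open Literature.NumberTheory.Rogawski1990
open Literature.NumberTheory.GelbartRogawski1991
open Literature.NumberTheory.Automorphic.Arthur2013.Leaves.TECR
open Literature.RepresentationTheory.Liu2021 (isOscillatorChar_toHeckeCharacter_iff isOscillatorChar_iff)

namespace Summit.HodgeConjecture.HodgeConjecture.Cruxes.H413.F0P2uXiOfThetaDatum

variable (L : Type) [Field L] [NumberField L] [IsCMField L]

/-! ## §1 The forward dictionary -/

/-- **THE FORWARD DICTIONARY `(μ, χ, μω) ↦ ξ`.**  For `μ` conjugate symplectic, `χ` an automorphic character of `L¹∖U(1)(𝔸_{L⁺,f})` and `μω` with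
`μω|_{𝕀_{L⁺}} = ε_{L∕L⁺}`, there is a one-dimensional automorphic `ξ = (η, ψ)` of `H = U(2) × U(1)` with
`μ̃ = η̃⁻¹ · ψ̃⁻¹ · μω` and `χ̌ = ψ̃⁻¹ · (η̃⁻¹ψ̃⁻¹μω)²` (`μ̃ = toHeckeCharacter μ`, `χ̌ = HeckeCharacter.checkOfChi`, `η̃ = ξ.bcη`, `ψ̃ = ξ.bcψ`).
Construction: `ψ̃ := μ̃²χ̌⁻¹`, `η̃ := μω μ̃⁻¹ ψ̃⁻¹`, both trivial on `𝕀_{L⁺}`, descended by idelic Hilbert 90.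
[cite: Rogawski1990, §12.2 (2) p. 174; §13.1 p. 199] [cite: GelbartRogawski1991, §5.1 (5.1.1) p. 465] [cite: Liu2021, App. D §D.1 (l. 5224)] -/
theorem exists_xi_dictionary (μω : HeckeCharacter L)
    (hquad : ∀ x : Literature.NumberTheory.GaloisRepresentations.ideleGroup ↥(maximalRealSubfield L),
      μω (AdeleRing.ideleBaseChange (↥(maximalRealSubfield L)) L x) = quadraticHeckeCharCM L x)
    (μ : Literature.NumberTheory.Automorphic.IdeleClassGroup L →ₜ* Circle) (hμ : IsConjugateSymplectic L μ)
    (hcc : IsCMField.complexConj L * IsCMField.complexConj L = 1)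
    (χ : Chi (↥(maximalRealSubfield L)) L (IsCMField.complexConj L)) :
    ∃ ξ : OneDimAutRepH L,
      toHeckeCharacter L μ = ξ.bcη⁻¹ * ξ.bcψ⁻¹ * μω ∧
      HeckeCharacter.checkOfChi hcc χ = ξ.bcψ⁻¹ * (ξ.bcη⁻¹ * ξ.bcψ⁻¹ * μω) ^ 2 := by
  have h2 : Module.finrank ↥(maximalRealSubfield L) L = 2 := Algebra.IsQuadraticExtension.finrank_eq_two _ L
  have hc : IsCMField.complexConj L ≠ 1 := IsCMField.complexConj_ne_one (K := L)
  -- `μ̃|_{𝕀_{L⁺}} = ε`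
  have hμsplit : ∀ x : Literature.NumberTheory.GaloisRepresentations.ideleGroup ↥(maximalRealSubfield L),
      toHeckeCharacter L μ (AdeleRing.ideleBaseChange (↥(maximalRealSubfield L)) L x) = quadraticHeckeCharCM L x :=
    (isOscillatorChar_iff (toHeckeCharacter L μ)).1 ((isOscillatorChar_toHeckeCharacter_iff μ).2 hμ)
  -- `ε² = 1`
  have hεsq : ∀ x : Literature.NumberTheory.GaloisRepresentations.ideleGroup ↥(maximalRealSubfield L), quadraticHeckeCharCM L x ^ 2 = 1 := fun x => by
    rw [← HeckeCharacter.pow_apply, quadraticHeckeCharCM_sq, HeckeCharacter.one_apply]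
  -- `ψ̃ := μ̃² χ̌⁻¹` is trivial on `𝕀_{L⁺}`
  have hψsplit : ∀ x : Literature.NumberTheory.GaloisRepresentations.ideleGroup ↥(maximalRealSubfield L),
      (toHeckeCharacter L μ ^ 2 * (HeckeCharacter.checkOfChi hcc χ)⁻¹) (AdeleRing.ideleBaseChange (↥(maximalRealSubfield L)) L x) = 1 := by
    intro x
    rw [HeckeCharacter.mul_apply, HeckeCharacter.pow_apply, HeckeCharacter.inv_apply, hμsplit, checkOfChi_ideleBaseChange, inv_one,
      mul_one, hεsq]
  obtain ⟨ψ, hψ, hψeq⟩ := TorusDict.exists_pullback_eq (IsCMField.complexConj L) h2 hc _ hψsplit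
  -- `η̃ := μω μ̃⁻¹ ψ̃⁻¹` is trivial on `𝕀_{L⁺}`
  -- (`η̃` is spelled `ψ̃⁻¹ μω μ̃⁻¹` so that both pins below are FREE-group identities, closed by `group`)
  have hηsplit : ∀ x : Literature.NumberTheory.GaloisRepresentations.ideleGroup ↥(maximalRealSubfield L),
      ((toHeckeCharacter L μ ^ 2 * (HeckeCharacter.checkOfChi hcc χ)⁻¹)⁻¹ * μω * (toHeckeCharacter L μ)⁻¹)
        (AdeleRing.ideleBaseChange (↥(maximalRealSubfield L)) L x) = 1 := by
    intro x
    rw [HeckeCharacter.mul_apply, HeckeCharacter.mul_apply, HeckeCharacter.inv_apply, HeckeCharacter.inv_apply, hquad, hμsplit, hψsplit,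
      inv_one, one_mul, mul_inv_cancel]
  obtain ⟨η, hη, hηeq⟩ := TorusDict.exists_pullback_eq (IsCMField.complexConj L) h2 hc _ hηsplit
  -- the candidate and its base changes (definitional: `bcη (ofAutomorphic η ψ _ _) = pullback η`)
  have e1 : (OneDimAutRepH.ofAutomorphic η ψ hη hψ).bcη =
      (toHeckeCharacter L μ ^ 2 * (HeckeCharacter.checkOfChi hcc χ)⁻¹)⁻¹ * μω * (toHeckeCharacter L μ)⁻¹ := hηeq
  have e2 : (OneDimAutRepH.ofAutomorphic η ψ hη hψ).bcψ = toHeckeCharacter L μ ^ 2 * (HeckeCharacter.checkOfChi hcc χ)⁻¹ := hψeq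
  refine ⟨OneDimAutRepH.ofAutomorphic η ψ hη hψ, ?_, ?_⟩
  · -- (hdμ): `(ψ̃⁻¹ μω μ̃⁻¹)⁻¹ ψ̃⁻¹ μω = μ̃`
    rw [e1, e2]
    group
  · -- (hdχ): `ψ̃⁻¹ (η̃⁻¹ψ̃⁻¹μω)² = ψ̃⁻¹ μ̃² = (μ̃²χ̌⁻¹)⁻¹ μ̃² = χ̌`
    rw [e1, e2]
    group

/-- **The forward dictionary in letter #76's literal pin shapes**: (hdμ) semilocally at every finite place of `L⁺`, and (hdχ) `χ(z∕z̄) = (ψ̃⁻¹(η̃⁻¹ψ̃⁻¹μω)²)((1_∞, z))`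
for every finite idèle `z` of `L` (`χ̌((1_∞, z)) = χ(z∕z̄)`, ★ `checkOfChi_apply`).
[cite: Rogawski1990, §12.2 (2) p. 174] [cite: GelbartRogawski1991, §5.1 (5.1.1) p. 465] [cite: Liu2021, App. D §D.1 (l. 5224)] -/
theorem exists_xi_dictionary_pins (μω : HeckeCharacter L)
    (hquad : ∀ x : Literature.NumberTheory.GaloisRepresentations.ideleGroup ↥(maximalRealSubfield L),
      μω (AdeleRing.ideleBaseChange (↥(maximalRealSubfield L)) L x) = quadraticHeckeCharCM L x)
    (μ : Literature.NumberTheory.Automorphic.IdeleClassGroup L →ₜ* Circle) (hμ : IsConjugateSymplectic L μ)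
    (hcc : IsCMField.complexConj L * IsCMField.complexConj L = 1)
    (χ : Chi (↥(maximalRealSubfield L)) L (IsCMField.complexConj L)) :
    ∃ ξ : OneDimAutRepH L,
      (∀ v : HeightOneSpectrum (𝓞 ↥(maximalRealSubfield L)),
          (toHeckeCharacter L μ).semilocalComponent L v = (ξ.bcη⁻¹ * ξ.bcψ⁻¹ * μω).semilocalComponent L v) ∧
      (∀ z : (FiniteAdeleRing (𝓞 L) L)ˣ,
          χ.1 (finAdelicCheck (↥(maximalRealSubfield L)) L (IsCMField.complexConj L) hcc z) =
            (ξ.bcψ⁻¹ * (ξ.bcη⁻¹ * ξ.bcψ⁻¹ * μω) ^ 2)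
              (Units.map (N := AdeleRing (𝓞 L) L) (MonoidHom.inr (InfiniteAdeleRing L) (FiniteAdeleRing (𝓞 L) L)) z)) := by
  obtain ⟨ξ, hμξ, hχξ⟩ := exists_xi_dictionary L μω hquad μ hμ hcc χ
  refine ⟨ξ, fun v => by rw [hμξ], fun z => ?_⟩
  have hfin : idelicFinPart L (Units.map (N := AdeleRing (𝓞 L) L) (MonoidHom.inr (InfiniteAdeleRing L) (FiniteAdeleRing (𝓞 L) L)) z) = z :=
    Units.ext rfl
  rw [← hχξ, checkOfChi_apply, hfin]

/-! ## §2 Consequence over ★ #76: the local theta type lies in the principal series of the GLOBAL `ξ` at every non-split place -/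

set_option synthInstance.maxHeartbeats 400000 in
set_option maxHeartbeats 8000000 in
/-- **ONE GLOBAL `ξ` FOR ALL NON-SPLIT PLACES.**  For Liu's theta datum `(μ, χ)` (`μ` conjugate symplectic, `χ ∈ Chi`) and Rogawski's `μω` (unitary,
`μω|_{𝕀_{L⁺}} = ε`), the forward dictionary `ξ` of §1 satisfies, at EVERY CM frame `(H, e₁, dV, g)`, EVERY non-split place `v` and EVERY form congruence
`(T, a)`: some constituent `x₀` of the principal series `i_G(χ_{ξ,v})`, `χ_{ξ,v} = cmXiTorusChar L v μω_v η_v ψ_v`, transported to `U(H)(L⁺_v)`, IS the local theta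
type `X_v(μ, ε, χ)` of some line class `ε` (★ #76 `GR91Lemma512NonsplitAsPrinted_holds` with its two dictionary pins DISCHARGED by `exists_xi_dictionary_pins`;
`χ` is continuous and unitary, ★ `norm_chi_eq_one_cm`).  This is the non-split local clause of «the theta lift `Θ_μ(χ)` lies in `Π(ξ)`» with a GLOBAL `ξ`.
[cite: GelbartRogawski1991, §5.1 (5.1.1) p. 465, Lem. 5.1.2 pp. 465–466] [cite: Rogawski1990, §12.2 (2) p. 174; §13.1 p. 199] -/
theorem exists_xi_thetaType_in_xiPrincipalSeries (μω : HeckeCharacter L) (hμu : μω.IsUnitary)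
    (hquad : ∀ x : Literature.NumberTheory.GaloisRepresentations.ideleGroup ↥(maximalRealSubfield L),
      μω (AdeleRing.ideleBaseChange (↥(maximalRealSubfield L)) L x) = quadraticHeckeCharCM L x)
    (μ : Literature.NumberTheory.Automorphic.IdeleClassGroup L →ₜ* Circle) (hμ : IsConjugateSymplectic L μ)
    (χ : Chi (↥(maximalRealSubfield L)) L (IsCMField.complexConj L)) :
    ∃ ξ : OneDimAutRepH L,
      (∀ v : HeightOneSpectrum (𝓞 ↥(maximalRealSubfield L)),
          (toHeckeCharacter L μ).semilocalComponent L v = (ξ.bcη⁻¹ * ξ.bcψ⁻¹ * μω).semilocalComponent L v) ∧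
      (∀ z : (FiniteAdeleRing (𝓞 L) L)ˣ,
          χ.1 (finAdelicCheck (↥(maximalRealSubfield L)) L (IsCMField.complexConj L)
              (AlgEquiv.ext fun x => by rw [AlgEquiv.mul_apply, IsCMField.complexConj_apply_apply, AlgEquiv.one_apply]) z) =
            (ξ.bcψ⁻¹ * (ξ.bcη⁻¹ * ξ.bcψ⁻¹ * μω) ^ 2)
              (Units.map (N := AdeleRing (𝓞 L) L) (MonoidHom.inr (InfiniteAdeleRing L) (FiniteAdeleRing (𝓞 L) L)) z)) ∧
      ∀ (H : Matrix (Fin 3) (Fin 3) L) (hH : (H.map (cmConjRingHom L))ᵀ = H) (hHd : IsUnit H.det)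
        {n' : ℕ} (e₁ : Fin 3 × Fin 1 ≃ Fin n') (dV : Fin 3 → L) (hdV : ∀ i, IsCMField.complexConj L (dV i) = dV i) (hdV0 : ∀ i, dV i ≠ 0) (g : GL (Fin 3) L)
        (hg : ((g : Matrix (Fin 3) (Fin 3) L).map (cmConjRingHom L))ᵀ * H * (g : Matrix (Fin 3) (Fin 3) L) = Matrix.diagonal dV)
        (v : HeightOneSpectrum (𝓞 ↥(maximalRealSubfield L))),
        (∀ w : PlacesOver L v, IsCMField.complexConj L • w.1 = w.1) →
        ∀ (T : GL (Fin 3) (UnitaryGroup.LocalRing L v)) (a : UnitaryGroup.LocalRing L v) (ha : IsUnit a)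
          (h : formCongr (conjLocal L (IsCMField.complexConj L) v) T (H.map (algebraMap L (UnitaryGroup.LocalRing L v))) =
            a • (Matrix.of fun i j : Fin 3 => if i.val + j.val + 1 = 3 then (1 : L) else 0).map (algebraMap L (UnitaryGroup.LocalRing L v))),
          ∃ x₀ : IrrClass (Gqs L v),
            x₀.IsConstituentOf (cmPrincipalSeries L 3 v (cmXiTorusChar L v (μω.semilocalComponent L v)
              (torusLocalComponent L (IsCMField.complexConj L) v ξ.η) (torusLocalComponent L (IsCMField.complexConj L) v ξ.ψ))) ∧
            ∃ ε : (↥(maximalRealSubfield L))ˣ,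
              ThetaTypeAtCM L H e₁ dV hdV hdV0 g hg μ hμ χ.1 ε v (IrrClass.comap (cmDatumLocalCongr L v T ha h).symm x₀) := by
  obtain ⟨ξ, hμξ, hχξ⟩ := exists_xi_dictionary_pins L μω hquad μ hμ
    (AlgEquiv.ext fun x => by rw [AlgEquiv.mul_apply, IsCMField.complexConj_apply_apply, AlgEquiv.one_apply]) χ
  refine ⟨ξ, hμξ, hχξ, ?_⟩
  intro H hH hHd n' e₁ dV hdV hdV0 g hg v hv T a ha h
  exact F0P2oLocalLettersHold.GR91Lemma512NonsplitAsPrinted_holds L H hH hHd e₁ dV hdV hdV0 g hg ξ μω hμu hquad μ hμ χ.1 χ.2.1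
    (norm_chi_eq_one_cm L χ) hμξ hχξ v hv T a ha h

end Summit.HodgeConjecture.HodgeConjecture.Cruxes.H413.F0P2uXiOfThetaDatum

end
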